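import Mathlib
import Literature.MathematicalPhysics.QuantumFieldTheory.Balaban1983to89.B6

/-!
# `Balaban1983to89.B6RandomWalk` — [Balaban1984PropagatorsII] Lemma 2.1 (p. 234): (2.60), (2.61) NAMED and the printed
"hence" (2.61) ⇒ (2.62), (2.61) + (2.54) ⇒ (2.63) KERNEL-CHECKED (the finite random-walk summations of Sect. 2); and the
kernel chain of Proposition 2.2 (pp. 232–234): (2.52)/(2.55)ₐ ⇒ (2.64) ⇒ (2.65) ⇒ (2.66) KERNEL-CHECKED over block majorants;
Proposition 2.6 (p. 247) "reasoning in the same way as in the proof of Proposition 2.2" = the same chain at the rate ½δ₂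

CITATION HEADER (lean-in-tree rule 2026-08-18).  Source: T. Bałaban, *Propagators and renormalization transformations for
lattice gauge theories. II*, Commun. Math. Phys. **96**, 223–250 (1984), doi:10.1007/bf01240221 (cell paper B6; held:
`paper:balaban1984-cmp96-propagators-rt-ii`; journal page = PDF page + 222; every quotation below is read from the page
renders pp. 224, 229–234 [PDF 2, 7–12], `b2b-balaban-ref1/pages/1984-cmp96-propagators-rt-II/…-p002,p007…p012-x2.png`).
WHAT IS REPRODUCED (statement level, surge nodes T03.1, T03.2, T03.6 "sharpen" of the cell's claim table; the sibling
module `…Balaban1983to89.B6` — whose `B6.Lemma21Printed` types (2.60) ∧ (2.61), `B6.Prop22Printed` (2.67) and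
`B6.Prop26Printed` (2.136)–(2.141) — is NOT modified):
(a) the two displayed inequalities (2.60), (2.61) of Lemma 2.1 as SEPARATE named Props `Ineq260`, `Ineq261` over the sibling
module's carrier `B6.Geometry`; `lemma21Printed_iff` records, by `Iff.rfl`, that `B6.Lemma21Printed` is literally
"∀ i, (2.1)–(2.2) → ∀ α ∈ ]0,1[, (2.59) → (2.60) ∧ (2.61)";
(b) the two further displayed inequalities (2.62), (2.63), which Lemma 2.1 states after the word *"hence"*, as named Props
`Ineq262`, `Ineq263` — the n-fold products summed over the intermediate points are typed as ITERATED finite sums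
(`openChain` = free end-point, (2.62); `chain` = fixed end-points, (2.63)); `openChain_eq_tupleSum` is the kernel-checked
Fubini identity with the printed sum over tuples (y₁, …, y_n) ∈ 𝔅ⁿ;
(c) KERNEL-CHECKED RE-DERIVATIONS of the word *"hence"*: (2.61) ⇒ (2.62) (`ineq262_of_261`: iterate the row-sum bound);
(2.61) + the triangle inequality (2.54) for the multiscale distance d ⇒ (2.63) (`ineq263_of_261`), following EXACTLY the
printed route p. 233: split e^{−δ₀d} = e^{−(1−α)δ₀d}·e^{−αδ₀d}, pull e^{−(1−α)δ₀d(y,y′)} out of the chain by (2.54)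
(this is the second of the two displays numbered "(2.55)", p. 233 top), then *"To estimate the sum above we add a summation
over y′ ∈ 𝔅"* (2.56) and use (2.61) n times.  CENSUS RESULT of (c): the printed exponent c₁(α)ⁿ in (2.63) (n factors,
n − 1 summed points) is obtained WITHOUT any lower bound c₁(α) ≥ 1, precisely because of the (2.56) device; the only
inputs beyond (2.61) are (2.54), 0 ≤ δ₀ and α ≤ 1 (all printed: 0 < α < 1, δ₀ > 0 the decay rate of Prop. 2.2).
(d) (node T03.2, section `Prop22Chain` below) the KERNEL CHAIN of the proof of Proposition 2.2, pp. 232–234: the printed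
bound shape *"|(Tλ)(x)| ≤ K e^{−δd(y,y′)}|λ|, x ∈ B^j(y), supp λ ⊂ B^{j′}(y′)"* is typed as `HasMajorant` (operator =
linear map on the functions on an abstract lattice `X`, blocks = fibres of `blk : X → 𝔅`); composition and summation of
majorants ((2.52) ⇒ (2.55)ₐ, `hasMajorant_mul`, `hasMajorant_pow_chain`), (2.51) + (2.63) ⇒ (2.64)–(2.65) (`majorant_pow_265`),
and (2.66): the G′₀-bound + (2.65) + (2.54) + (2.61) + the geometric series ⇒ the first entry of (2.67) for every operator G′
with G′ = G′₀ + G′R ((2.38)/(2.50)), with the constant O(1) = A c₁(α)(1 − θc₁(α))⁻¹ EXPLICIT and valid exactly under the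
LOCATED smallness θc₁(α) < 1, θ = O(M⁻¹) of (2.51) — Prop. 2.2's *"M is sufficiently large"* (cell SMALLNESS.md /
GAPS.md C-pv08-2).  Every analytic input of (d) is a hypothesis OF THE PRINTED SHAPE ((2.51) for R; the (2.37)/(2.43)/(2.44)
bound for G′₀; (2.61), (2.63); (2.54); d(y,y) = 0, d ≥ 0), never an internally minted fact.
(e) (node T03.6, section `Prop26Chain`) Prop. 2.6 p. 247: the printed *"Reasoning in the same way as in the proof of
Proposition 2.2"* from (2.135) and (2.91)/(2.141) IS the instance of (d) at the rate ½δ₂ (`prop26_chain_2136`), with the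
printed δ₃ = (1 − α)·½δ₂ (`delta3`, `delta3_pos`) and O(1) = A c₁(d, ½δ₂, α)(1 − O(M⁻¹)c₁)⁻¹ (`const2136`; ≤ 2A c₁ under
the margin O(M⁻¹)c₁ ≤ ½, `const2136_le_of_margin`) explicit — locating that Lemma 2.1 is used at the rate ½δ₂ and that
Prop. 2.6 inherits Prop. 2.2's M-largeness (cell GAPS G-pv08-3, SMALLNESS S-B6.2).
WHAT IS *NOT* REPRODUCED OR ASSERTED: (2.60), (2.61) themselves (their printed proof, pp. 231–233, rests on the contour
decomposition (2.47)–(2.48) and the lattice-point count (2.58) — analytic/geometric leaves, census row G-B6-04 of the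
cell's GAPS.md reproduces the constants); the triangle inequality (2.54) (p. 233: *"This is of course the triangle
inequality for our distance"*, immediate from the definition (2.46) by concatenation of admissible contours) enters as the
explicit hypothesis `Triangle254`; of Prop. 2.2 NOT typed: (2.51) itself (its printed derivation from (2.44) via (2.38)–(2.40)),
the G′₀ bound (from (2.37) and (2.43) = [3] = B5, Lemmas 2.2, 2.4, Prop. 2.3), the comparison between the scaled euclidean
distance (L^jη)^{−1}|y − y″| of (2.43)/(2.44)/(2.66) and the multiscale distance d of (2.46) within the range 2dM of one block
(LOCATED, GAPS.md G-pv08-2), the operators Δ′_a, G′(□), K(h□) themselves, and the derivative / Hölder entries of (2.67) beyond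
the remark that they have the same shape with another prefactor P(y).  PRINT ANOMALIES recorded (cell DIVERGENCE.md D-pv08.1): (i) p. 232 carries the labels (2.51), (2.52), (2.55)
and p. 233 the labels (2.54), (2.55), (2.56) — two displays are numbered (2.55), none (2.53); below "(2.55)ₐ" = p. 232
bottom, "(2.55)_b" = p. 233; (ii) in (2.63) the last factor is printed e^{−δ₀d(y_{n−1},y₁)} where (2.55)ₐ, (2.55)_b, (2.56)
and the right-hand side e^{−(1−α)δ₀d(y,y′)} have y′ — typed with y′ (see `Ineq263`).  NOTHING of the series is asserted; value = typed skeleton + kernel-checked bookkeeping, NOT summit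
progress.  Unit `b2b-balaban-pv08` (surge node prover #08); companion rows: cell `GAPS.md` C-pv08-1, C-pv08-2, C-pv08-3,
G-pv08-1, G-pv08-2, G-pv08-3, `DIVERGENCE.md` D-pv08.1, D-pv08.2, `SMALLNESS.md` S-B6.1, S-B6.2.
-/

namespace Literature.MathematicalPhysics.QuantumFieldTheory.Balaban1983to89.B6RandomWalk

open Literature.MathematicalPhysics.QuantumFieldTheory.Balaban1983to89
open Finset

/-! ## (2.60), (2.61) named -/

/-- **(2.60)** of Lemma 2.1, verbatim (p. 234 [12]): *"e^{−αδ₀d(y,y′)} ≤ e^{−αδ₀RM max{|j−j′|−1,0}}, y ∈ Λ_j, y′ ∈ Λ_{j′},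
(2.60)"* — for ONE multiscale geometry `g` (𝔅 = `g.Site`, j = `g.scale y`, d = `g.dist`, R, M of (2.1)–(2.2)) and given
α, δ₀: the first conjunct of `B6.Lemma21Printed`. [cite: Balaban1984PropagatorsII, (2.60) p.234] -/
def Ineq260 (g : B6.Geometry) (δ₀ α : ℝ) : Prop :=
  ∀ y y' : g.Site,
    Real.exp (-(α * δ₀ * g.dist y y')) ≤
      Real.exp (-(α * δ₀ * g.R * g.M * max ((|(g.scale y : ℝ) - g.scale y'|) - 1) 0))

/-- **(2.61)** of Lemma 2.1, verbatim (p. 234 [12]): *"sup_{y∈𝔅} Σ_{y′∈𝔅} e^{−αδ₀d(y,y′)} ≤ c₁(α), (2.61)"* with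
*"c₁(α) = 12c₀^d(½α)"* (= `B6.c1 d δ₀ α`): the second conjunct of `B6.Lemma21Printed` (the sup over the finite set 𝔅 is
typed as "for every y"). [cite: Balaban1984PropagatorsII, (2.61) p.234] -/
def Ineq261 (d : ℕ) (g : B6.Geometry) (δ₀ α : ℝ) : Prop :=
  ∀ y : g.Site, ∑ y' : g.Site, Real.exp (-(α * δ₀ * g.dist y y')) ≤ B6.c1 d δ₀ α

/-- Bookkeeping (by `Iff.rfl`): the sibling module's `B6.Lemma21Printed` IS "for every geometry of the family satisfying
(2.1)–(2.2), every 0 < α < 1 and RM satisfying (2.59): (2.60) ∧ (2.61)", with the two inequalities named. [folklore] -/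
theorem lemma21Printed_iff {I : Type} (d : ℕ) (δ₀ : ℝ) (geo : I → B6.Geometry) :
    B6.Lemma21Printed d δ₀ geo ↔
      ∀ i : I, (geo i).Hyp21_22 → ∀ α : ℝ, 0 < α → α < 1 → B6.Cond259 d δ₀ α (geo i).R (geo i).M →
        Ineq260 (geo i) δ₀ α ∧ Ineq261 d (geo i) δ₀ α :=
  Iff.rfl

/-! ## Iterated chain sums over a finite set (the sums of (2.52), (2.55)–(2.56), (2.62)–(2.63)) -/

section Chains

variable {S : Type} [Fintype S]

/-- The CLOSED chain sum with fixed end-points y, y′ and `m + 1` factors: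
`chain w m y y′ = Σ_{y₁,…,y_m ∈ S} w(y,y₁) w(y₁,y₂) ⋯ w(y_m,y′)` (so the printed sum of (2.63), with n factors and the
n − 1 intermediate points y₁, …, y_{n−1}, is `chain w (n−1) y y′`), defined by the recursion "sum over the first
intermediate point". [cite: Balaban1984PropagatorsII, (2.52)/(2.63) pp.232–234] -/
def chain (w : S → S → ℝ) : ℕ → S → S → ℝ
  | 0, y, y' => w y y'
  | m + 1, y, y' => ∑ z : S, w y z * chain w m z y'

/-- The OPEN chain sum with fixed initial point y, `m + 1` factors and the LAST point summed as well:
`openChain w m y = Σ_{y₁,…,y_{m+1} ∈ S} w(y,y₁) ⋯ w(y_m,y_{m+1})` (the printed sum of (2.62) with n = m + 1 factors).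
[cite: Balaban1984PropagatorsII, (2.62) p.234] -/
def openChain (w : S → S → ℝ) : ℕ → S → ℝ
  | 0, y => ∑ y' : S, w y y'
  | m + 1, y => ∑ z : S, w y z * openChain w m z

/-- Unfolding equation: one factor, no intermediate point. [folklore] -/
@[simp] theorem chain_zero (w : S → S → ℝ) (y y' : S) : chain w 0 y y' = w y y' := rfl

/-- Unfolding equation: sum over the first intermediate point. [folklore] -/
@[simp] theorem chain_succ (w : S → S → ℝ) (m : ℕ) (y y' : S) :
    chain w (m + 1) y y' = ∑ z : S, w y z * chain w m z y' := rfl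

/-- Unfolding equation: one factor, end-point summed. [folklore] -/
@[simp] theorem openChain_zero (w : S → S → ℝ) (y : S) : openChain w 0 y = ∑ y' : S, w y y' := rfl

/-- Unfolding equation: sum over the first intermediate point. [folklore] -/
@[simp] theorem openChain_succ (w : S → S → ℝ) (m : ℕ) (y : S) :
    openChain w (m + 1) y = ∑ z : S, w y z * openChain w m z := rfl

/-- *"To estimate the sum above we add a summation over y′ ∈ 𝔅"* (p. 233, the step to (2.56)): summing the closed chain
over its end-point gives the open chain (Fubini for finite sums). [cite: Balaban1984PropagatorsII, (2.56) p.233] -/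
theorem sum_chain_eq_openChain (w : S → S → ℝ) (m : ℕ) (y : S) :
    ∑ y' : S, chain w m y y' = openChain w m y := by
  induction m generalizing y with
  | zero => simp
  | succ m ih =>
      simp only [chain_succ, openChain_succ]
      rw [Finset.sum_comm]
      refine Finset.sum_congr rfl fun z _ => ?_
      rw [← Finset.mul_sum, ih z]

/-- Closed chains of a non-negative weight are non-negative. [folklore] -/
theorem chain_nonneg (w : S → S → ℝ) (hw : ∀ a b, 0 ≤ w a b) (m : ℕ) (y y' : S) : 0 ≤ chain w m y y' := by
  induction m generalizing y with
  | zero => simpa using hw y y'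
  | succ m ih =>
      rw [chain_succ]
      exact Finset.sum_nonneg fun z _ => mul_nonneg (hw y z) (ih z)

/-- Open chains of a non-negative weight are non-negative. [folklore] -/
theorem openChain_nonneg (w : S → S → ℝ) (hw : ∀ a b, 0 ≤ w a b) (m : ℕ) (y : S) : 0 ≤ openChain w m y := by
  rw [← sum_chain_eq_openChain]
  exact Finset.sum_nonneg fun y' _ => chain_nonneg w hw m y y'

/-- (2.56), one chain: for non-negative weights the closed chain is at most the open one (the added summation over the
end-point only adds non-negative terms). [cite: Balaban1984PropagatorsII, (2.56) p.233] -/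
theorem chain_le_openChain (w : S → S → ℝ) (hw : ∀ a b, 0 ≤ w a b) (m : ℕ) (y y' : S) :
    chain w m y y' ≤ openChain w m y := by
  rw [← sum_chain_eq_openChain]
  exact Finset.single_le_sum (fun z _ => chain_nonneg w hw m y z) (Finset.mem_univ y')

/-- (2.61) ⇒ (2.62), abstract form: if every row sum of the non-negative weight is ≤ c, the open chain with m + 1 factors
is ≤ c^{m+1} (and then (2.56): *"≤ (sup_{y∈𝔅} Σ_{y′∈𝔅} e^{−αδ₀d(y,y′)})ⁿ"*). [cite: Balaban1984PropagatorsII, (2.56)/(2.62) pp.233–234] -/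
theorem openChain_le_pow (w : S → S → ℝ) (hw : ∀ a b, 0 ≤ w a b) (c : ℝ) (hc : ∀ a, ∑ b : S, w a b ≤ c)
    (m : ℕ) (y : S) : openChain w m y ≤ c ^ (m + 1) := by
  induction m generalizing y with
  | zero => simpa using hc y
  | succ m ih =>
      have hc0 : 0 ≤ c := le_trans (Finset.sum_nonneg fun b _ => hw y b) (hc y)
      rw [openChain_succ]
      calc ∑ z : S, w y z * openChain w m z
          ≤ ∑ z : S, w y z * c ^ (m + 1) :=
            Finset.sum_le_sum fun z _ => mul_le_mul_of_nonneg_left (ih z) (hw y z)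
        _ = (∑ z : S, w y z) * c ^ (m + 1) := by rw [Finset.sum_mul]
        _ ≤ c * c ^ (m + 1) := mul_le_mul_of_nonneg_right (hc y) (pow_nonneg hc0 _)
        _ = c ^ (m + 1 + 1) := by ring

/-- The printed sum over TUPLES: `tupleSum w n y = Σ_{(y₁,…,y_n) ∈ Sⁿ} Π_{i=1}^{n} w(y_{i−1}, y_i)` with y₀ = y, typed
with `ys : Fin n → S` and `Fin.cons y ys` supplying the previous point. [cite: Balaban1984PropagatorsII, (2.62) p.234] -/
def tupleSum (w : S → S → ℝ) (n : ℕ) (y : S) : ℝ :=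
  ∑ ys : Fin n → S, ∏ i : Fin n, w ((Fin.cons y ys : Fin (n + 1) → S) (Fin.castSucc i)) (ys i)

/-- Recursion of the tuple sum (split off the first summation variable y₁; Fubini). [folklore] -/
theorem tupleSum_succ (w : S → S → ℝ) (n : ℕ) (y : S) :
    tupleSum w (n + 1) y = ∑ z : S, w y z * tupleSum w n z := by
  unfold tupleSum
  rw [← Fintype.sum_equiv (Fin.consEquiv fun _ : Fin (n + 1) => S)
    (fun p : S × (Fin n → S) =>
      ∏ i : Fin (n + 1), w ((Fin.cons y (Fin.cons p.1 p.2) : Fin (n + 2) → S) (Fin.castSucc i))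
        ((Fin.cons p.1 p.2 : Fin (n + 1) → S) i))
    (fun ys : Fin (n + 1) → S =>
      ∏ i : Fin (n + 1), w ((Fin.cons y ys : Fin (n + 2) → S) (Fin.castSucc i)) (ys i))
    (fun _ => rfl),
    Fintype.sum_prod_type]
  refine Finset.sum_congr rfl fun z _ => ?_
  rw [Finset.mul_sum]
  refine Finset.sum_congr rfl fun ys _ => ?_
  rw [Fin.prod_univ_succ]
  have h0 : (Fin.cons y (Fin.cons z ys) : Fin (n + 2) → S) (Fin.castSucc 0) = y := by simp
  have h0' : (Fin.cons z ys : Fin (n + 1) → S) 0 = z := by simp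
  have h1 : ∀ i : Fin n, (Fin.cons y (Fin.cons z ys) : Fin (n + 2) → S) (Fin.castSucc (Fin.succ i)) =
      (Fin.cons z ys : Fin (n + 1) → S) (Fin.castSucc i) := fun i => by
    rw [← Fin.succ_castSucc, Fin.cons_succ]
  have h2 : ∀ i : Fin n, (Fin.cons z ys : Fin (n + 1) → S) (Fin.succ i) = ys i := fun i => by simp
  rw [h0, h0']
  simp only [h1, h2]

/-- The empty tuple: the empty product summed once. [folklore] -/
@[simp] theorem tupleSum_zero (w : S → S → ℝ) (y : S) : tupleSum w 0 y = 1 := by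
  simp [tupleSum]

/-- KERNEL-CHECKED FUBINI: the iterated open chain with m + 1 factors IS the printed sum over tuples
(y₁, …, y_{m+1}) ∈ 𝔅^{m+1} of the product of the m + 1 factors, i.e. the left-hand side of (2.62) with n = m + 1. [folklore] -/
theorem openChain_eq_tupleSum (w : S → S → ℝ) (m : ℕ) (y : S) : openChain w m y = tupleSum w (m + 1) y := by
  induction m generalizing y with
  | zero => simp [tupleSum_succ]
  | succ m ih =>
      rw [openChain_succ, tupleSum_succ]
      exact Finset.sum_congr rfl fun z _ => by rw [ih z]

/-- The split behind "(2.55)_b" (p. 233 top): with the triangle inequality (2.54) for d and (1 − α)δ₀ ≥ 0,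
`Σ e^{−δ₀d(y,y₁)}⋯e^{−δ₀d(y_m,y′)} ≤ e^{−(1−α)δ₀d(y,y′)} Σ e^{−αδ₀d(y,y₁)}⋯e^{−αδ₀d(y_m,y′)}` — proved by induction on
the length of the chain, splitting each factor e^{−δ₀d} = e^{−(1−α)δ₀d}e^{−αδ₀d}. [cite: Balaban1984PropagatorsII, (2.54)–(2.55) p.233] -/
theorem chain_split (dist : S → S → ℝ) (htri : ∀ a b c : S, dist a c ≤ dist a b + dist b c)
    (δ₀ α : ℝ) (hαδ : 0 ≤ (1 - α) * δ₀) (m : ℕ) (y y' : S) :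
    chain (fun a b => Real.exp (-(δ₀ * dist a b))) m y y' ≤
      Real.exp (-((1 - α) * δ₀ * dist y y')) * chain (fun a b => Real.exp (-(α * δ₀ * dist a b))) m y y' := by
  induction m generalizing y with
  | zero =>
      simp only [chain_zero]
      rw [← Real.exp_add]
      exact le_of_eq (by ring_nf)
  | succ m ih =>
      rw [chain_succ, chain_succ, Finset.mul_sum]
      refine Finset.sum_le_sum fun z _ => ?_
      have hz := ih z
      have hwα : 0 ≤ chain (fun a b => Real.exp (-(α * δ₀ * dist a b))) m z y' :=
        chain_nonneg _ (fun _ _ => Real.exp_nonneg _) m z y'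
      calc Real.exp (-(δ₀ * dist y z)) * chain (fun a b => Real.exp (-(δ₀ * dist a b))) m z y'
          ≤ Real.exp (-(δ₀ * dist y z)) *
              (Real.exp (-((1 - α) * δ₀ * dist z y')) *
                chain (fun a b => Real.exp (-(α * δ₀ * dist a b))) m z y') :=
            mul_le_mul_of_nonneg_left hz (Real.exp_nonneg _)
        _ = Real.exp (-((1 - α) * δ₀ * (dist y z + dist z y'))) *
              (Real.exp (-(α * δ₀ * dist y z)) *
                chain (fun a b => Real.exp (-(α * δ₀ * dist a b))) m z y') := by
            rw [← mul_assoc, ← mul_assoc, ← Real.exp_add, ← Real.exp_add]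
            congr 2
            ring
        _ ≤ Real.exp (-((1 - α) * δ₀ * dist y y')) *
              (Real.exp (-(α * δ₀ * dist y z)) *
                chain (fun a b => Real.exp (-(α * δ₀ * dist a b))) m z y') := by
            refine mul_le_mul_of_nonneg_right ?_ (mul_nonneg (Real.exp_nonneg _) hwα)
            refine Real.exp_le_exp.mpr ?_
            have := mul_le_mul_of_nonneg_left (htri y z y') hαδ
            linarith

end Chains

/-! ## (2.62), (2.63) named and derived -/

/-- **(2.62)** of Lemma 2.1, verbatim (p. 234 [12]): *"hence Σ_{y₁,…,y_n∈𝔅} e^{−αδ₀d(y,y₁)}·…·e^{−αδ₀d(y_{n−1},y_n)} ≤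
c₁(α)ⁿ (2.62)"* — typed for ONE geometry with n = m + 1 ≥ 1 factors as the iterated sum `openChain`
(= the printed tuple sum by `openChain_eq_tupleSum`). [cite: Balaban1984PropagatorsII, (2.62) p.234] -/
def Ineq262 (d : ℕ) (g : B6.Geometry) (δ₀ α : ℝ) : Prop :=
  ∀ (m : ℕ) (y : g.Site),
    openChain (fun a b : g.Site => Real.exp (-(α * δ₀ * g.dist a b))) m y ≤ B6.c1 d δ₀ α ^ (m + 1)

/-- **(2.63)** of Lemma 2.1, verbatim (p. 234 [12]): *"and Σ_{y₁,…,y_{n−1}∈𝔅} e^{−δ₀d(y,y₁)}·…·e^{−δ₀d(y_{n−1},y₁)} ≤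
c₁(α)ⁿe^{−(1−α)δ₀d(y,y′)}. (2.63)"* — the last factor is PRINTED "d(y_{n−1}, y₁)" [sic]; it is typed as d(y_{n−1}, y′),
which is what the right-hand side, the summation range y₁, …, y_{n−1} and the displays (2.55) (pp. 232, 233), (2.56) it
summarises all carry (recorded in the cell's DIVERGENCE.md, D-pv08.1).  Typed for ONE geometry with n = m + 1 ≥ 1 factors
(m intermediate points) as the iterated closed chain `chain`. [cite: Balaban1984PropagatorsII, (2.63) p.234] -/
def Ineq263 (d : ℕ) (g : B6.Geometry) (δ₀ α : ℝ) : Prop :=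
  ∀ (m : ℕ) (y y' : g.Site),
    chain (fun a b : g.Site => Real.exp (-(δ₀ * g.dist a b))) m y y' ≤
      B6.c1 d δ₀ α ^ (m + 1) * Real.exp (-((1 - α) * δ₀ * g.dist y y'))

/-- **(2.54)** (p. 233 [11]), verbatim: *"d(y, y₁) + d(y₁, y₂) + … + d(y_{n−1}, y′) ≥ d(y, y′). (2.54) This is of course
the triangle inequality for our distance."* — typed in its binary form (n = 2), from which the n-fold form follows and
which is how `chain_split` consumes it; a property of the multiscale distance (2.46), entering here as a HYPOTHESIS on the
abstract carrier `B6.Geometry.dist`. [cite: Balaban1984PropagatorsII, (2.54) p.233] -/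
def Triangle254 (g : B6.Geometry) : Prop :=
  ∀ a b c : g.Site, g.dist a c ≤ g.dist a b + g.dist b c

/-- KERNEL-CHECKED "hence", first half: (2.61) ⇒ (2.62). [cite: Balaban1984PropagatorsII, Lemma 2.1 p.234] -/
theorem ineq262_of_261 (d : ℕ) (g : B6.Geometry) (δ₀ α : ℝ) (h261 : Ineq261 d g δ₀ α) : Ineq262 d g δ₀ α :=
  fun m y => openChain_le_pow _ (fun _ _ => Real.exp_nonneg _) _ h261 m y

/-- KERNEL-CHECKED "hence", second half: (2.61) + (2.54) ⇒ (2.63), along the printed route (2.55)_b → (2.56) → (2.61);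
inputs beyond (2.61): the triangle inequality, 0 ≤ δ₀ and α ≤ 1 — and NO lower bound on c₁(α).
[cite: Balaban1984PropagatorsII, Lemma 2.1 p.234 + (2.54)–(2.56) p.233] -/
theorem ineq263_of_261 (d : ℕ) (g : B6.Geometry) (δ₀ α : ℝ) (htri : Triangle254 g) (hδ : 0 ≤ δ₀) (hα : α ≤ 1)
    (h261 : Ineq261 d g δ₀ α) : Ineq263 d g δ₀ α := by
  intro m y y'
  have hsplit := chain_split g.dist htri δ₀ α (mul_nonneg (by linarith) hδ) m y y'
  have hopen : chain (fun a b : g.Site => Real.exp (-(α * δ₀ * g.dist a b))) m y y' ≤ B6.c1 d δ₀ α ^ (m + 1) :=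
    le_trans (chain_le_openChain _ (fun _ _ => Real.exp_nonneg _) m y y') (ineq262_of_261 d g δ₀ α h261 m y)
  calc chain (fun a b : g.Site => Real.exp (-(δ₀ * g.dist a b))) m y y'
      ≤ Real.exp (-((1 - α) * δ₀ * g.dist y y')) *
          chain (fun a b : g.Site => Real.exp (-(α * δ₀ * g.dist a b))) m y y' := hsplit
    _ ≤ Real.exp (-((1 - α) * δ₀ * g.dist y y')) * B6.c1 d δ₀ α ^ (m + 1) :=
        mul_le_mul_of_nonneg_left hopen (Real.exp_nonneg _)
    _ = B6.c1 d δ₀ α ^ (m + 1) * Real.exp (-((1 - α) * δ₀ * g.dist y y')) := mul_comm _ _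

/-- **Lemma 2.1 with its "hence" discharged**: from the sibling module's `B6.Lemma21Printed` ((2.60) ∧ (2.61)) and the
triangle inequality (2.54) for every geometry of the family, all four displayed inequalities (2.60)–(2.63) hold for
every 0 < α < 1 and RM satisfying (2.59) (δ₀ ≥ 0 as printed: δ₀ is the decay rate of Prop. 2.2).
[cite: Balaban1984PropagatorsII, Lemma 2.1 (2.60)–(2.63) p.234] -/
theorem lemma21_full {I : Type} (d : ℕ) (δ₀ : ℝ) (hδ : 0 ≤ δ₀) (geo : I → B6.Geometry)
    (htri : ∀ i, Triangle254 (geo i)) (h : B6.Lemma21Printed d δ₀ geo) :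
    ∀ i : I, (geo i).Hyp21_22 → ∀ α : ℝ, 0 < α → α < 1 → B6.Cond259 d δ₀ α (geo i).R (geo i).M →
      Ineq260 (geo i) δ₀ α ∧ Ineq261 d (geo i) δ₀ α ∧ Ineq262 d (geo i) δ₀ α ∧ Ineq263 d (geo i) δ₀ α := by
  intro i hH α hα0 hα1 hcond
  obtain ⟨h260, h261⟩ := (lemma21Printed_iff d δ₀ geo).mp h i hH α hα0 hα1 hcond
  exact ⟨h260, h261, ineq262_of_261 d (geo i) δ₀ α h261,
    ineq263_of_261 d (geo i) δ₀ α (htri i) hδ hα1.le h261⟩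

/-! ## Proposition 2.2 — the kernel chain (2.52)/(2.55)ₐ → (2.64) → (2.65) → (2.66) (surge node T03.2)

[Balaban1984PropagatorsII] pp. 229–234 [PDF 7–12].  The bounds of Sect. B are all of ONE printed shape — (2.51) p. 232:
*"|(Rλ)(x)| ≤ O(M⁻¹)e^{−δ₀d(x,y)}|λ| if supp λ ⊂ B^j(y), y ∈ Λ_j"*, (2.64)–(2.66) p. 234: *"x ∈ B^j(y), supp λ ⊂ B^{j′}(y′)"*
— an operator T on functions on the lattice T_η, the sup norm |λ| of a function supported in ONE block B^{j′}(y′), and a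
bound at the points of another block B^j(y) by a kernel K(y, y′) on 𝔅 × 𝔅.  We type exactly this shape
(`HasMajorant`): the lattice is an abstract type `X` (finite where the limit N → ∞ is taken), the blocks are the
fibres of a map `blk : X → 𝔅`
((2.4) p. 224: *"T = ⋃_{j=0}^{k} B^j(Λ_j)"*, the blocks B^j(y), y ∈ 𝔅 = ⋃_j Λ_j (2.45), partition T_η; p. 231 writes
y^j(x) for the block of x: *"d(x, x′) = d(y^j(x), y^{j′}(x′)) if x ∈ B^j(Λ_j), x′ ∈ B^{j′}(Λ_{j′})"*), operators are
linear maps `Module.End ℝ (X → ℝ)`.  KERNEL-CHECKED (every analytic input a hypothesis of the printed shape):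
* (2.52) ⇒ (2.55)ₐ p. 232 (`hasMajorant_mul`, `hasMajorant_pow_chain`): *"the point is that this property is preserved
  under the composition of operators possessing it. A summation preserves it also"* — majorants compose by 𝔅-convolution
  (inserting the block decomposition Δ(y) = B^j(y) of (2.52)) and add (`hasMajorant_add`, `hasMajorant_sum`); the n-fold
  composition of one operator has the closed chain `chain K (n−1)` of Lemma 2.1 as majorant;
* (2.64)–(2.65) p. 234 (`majorant_pow_265`): (2.51) [majorant θe^{−δ₀d}, θ = O(M⁻¹)] + (2.63) ⇒ Rⁿ has majorant
  (θc₁(α))ⁿe^{−(1−α)δ₀d(y,y′)} (printed with α = ½: *"|(Rⁿλ)(x)| ≤ (O(M⁻¹)c₁)ⁿe^{−½δ₀d(y,y′)}|λ|"*; n = 0 uses d(y,y) = 0);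
* (2.66) p. 234 (`majorant_G0_mul_265`, `majorant_partialSum_266`, `majorant_of_fixedPoint_266`): with a G′₀-majorant
  A·P(y)·e^{−δ₀d(y,y″)} (the printed (2.37)/(2.43)/(2.44) local bound, P(y) = (L^jη)² resp. L^jη, (L^jη)^{1−α} for the other
  entries of (2.67): *"The similar inequalities hold for a derivative of G′λ and for a Hölder norm of a derivative, but with
  (L^jη)² replaced by L^jη and (L^jη)^{1−α} correspondingly"*) every partial sum Σ_{n<N} G′₀Rⁿ of (2.50) has majorant
  A c₁(α)(1 − θc₁(α))⁻¹ P(y) e^{−(1−α)δ₀d(y,y′)} UNIFORMLY in N, provided the LOCATED smallness θc₁(α) < 1 (*"M is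
  sufficiently large"* of Prop. 2.2; cell SMALLNESS.md) — and so has every operator G′ with G′ = G′₀ + G′R, which is what
  (2.38) *"Δ′_aG′₀ = I − R"* gives for G′ = Δ′_a^{−1} (multiply by G′ on the left), i.e. (2.50) *"G′ = G′₀(I − R)^{−1} =
  G′₀Σ_{n=0}^∞ Rⁿ"*; the passage to the limit uses only that G′ is SOME linear map on the finite lattice (`exists_opBound`).
  With α = ½ this is the first entry of (2.67) with O(1) = A c₁(½)/(1 − O(M⁻¹)c₁(½)) explicit.
NOT typed here (hypotheses of the printed shape instead): (2.51) itself (from (2.44) + (2.38)), the G′₀ bound (from (2.43)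
= Lemmas 2.2, 2.4, Prop. 2.3 of [3] = B5, and (2.40)), the comparison of the scaled euclidean distance of (2.43)/(2.66) with
the multiscale distance d of (2.46) inside one block range (located: cell GAPS G-pv08-1), d(y,y) = 0 and d ≥ 0 ((2.46)),
the triangle inequality (2.54). -/

section Prop22Chain

variable {g : B6.Geometry} {X : Type}

/-- *"supp λ ⊂ B^{j′}(y′)"* with *"|λ|"* ≤ B (pp. 232, 234): the function μ on the lattice vanishes outside the block of y′
and is bounded by B ≥ 0 on it. [cite: Balaban1984PropagatorsII, (2.51) p.232] -/
structure BlockSupp (blk : X → g.Site) (μ : X → ℝ) (y' : g.Site) (B : ℝ) : Prop where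
  nonneg : 0 ≤ B
  bound : ∀ x, blk x = y' → |μ x| ≤ B
  off : ∀ x, blk x ≠ y' → μ x = 0

/-- The printed shape of (2.51), (2.55), (2.64)–(2.66): *"|(Tλ)(x)| ≤ K(y, y′)|λ|, x ∈ B^j(y), supp λ ⊂ B^{j′}(y′)"* —
the operator T has the MAJORANT K on 𝔅 × 𝔅 (with respect to the block map `blk` = y^j(·) of p. 231).
[cite: Balaban1984PropagatorsII, (2.51) p.232 + (2.64)–(2.66) p.234] -/
def HasMajorant (blk : X → g.Site) (T : Module.End ℝ (X → ℝ)) (K : g.Site → g.Site → ℝ) : Prop :=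
  ∀ (y' : g.Site) (μ : X → ℝ) (B : ℝ), BlockSupp blk μ y' B → ∀ x : X, |T μ x| ≤ K (blk x) y' * B

open Classical in
/-- Δ(y)ν (p. 232: *"where Δ(y) = B^j(y) if y ∈ Λ_j"*): the restriction of ν to the block of y.
[cite: Balaban1984PropagatorsII, (2.52) p.232] -/
noncomputable def blockPiece (blk : X → g.Site) (y : g.Site) (ν : X → ℝ) : X → ℝ :=
  fun x => if blk x = y then ν x else 0

/-- Σ_{y∈𝔅} Δ(y) = I (the blocks partition the lattice, (2.4) p. 224). [folklore] -/
theorem sum_blockPiece (blk : X → g.Site) (ν : X → ℝ) : ∑ y : g.Site, blockPiece blk y ν = ν := by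
  classical
  funext x
  rw [Finset.sum_apply]
  simp only [blockPiece]
  rw [Finset.sum_ite_eq]
  simp

/-- Each piece Δ(y″)ν is supported in the block of y″ and inherits the bound ν has there. [folklore] -/
theorem blockSupp_blockPiece (blk : X → g.Site) (ν : X → ℝ) (y'' : g.Site) (B : ℝ) (hB : 0 ≤ B)
    (hν : ∀ x, blk x = y'' → |ν x| ≤ B) : BlockSupp blk (blockPiece blk y'' ν) y'' B := by
  refine ⟨hB, fun x hx => ?_, fun x hx => ?_⟩
  · simpa [blockPiece, hx] using hν x hx
  · simp [blockPiece, hx]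

/-- Monotonicity of majorants. [folklore] -/
theorem hasMajorant_mono (blk : X → g.Site) {T : Module.End ℝ (X → ℝ)} {K K' : g.Site → g.Site → ℝ}
    (h : HasMajorant blk T K) (hle : ∀ a b, K a b ≤ K' a b) : HasMajorant blk T K' :=
  fun y' μ B hμ x => (h y' μ B hμ x).trans (mul_le_mul_of_nonneg_right (hle _ _) hμ.nonneg)

/-- The zero operator has the zero majorant. [folklore] -/
theorem hasMajorant_zero (blk : X → g.Site) : HasMajorant blk (0 : Module.End ℝ (X → ℝ)) (fun _ _ => 0) := by
  intro y' μ B hμ x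
  simp

/-- *"A summation preserves it also"* (p. 232): majorants add. [cite: Balaban1984PropagatorsII, p.232] -/
theorem hasMajorant_add (blk : X → g.Site) {T₁ T₂ : Module.End ℝ (X → ℝ)} {K₁ K₂ : g.Site → g.Site → ℝ}
    (h₁ : HasMajorant blk T₁ K₁) (h₂ : HasMajorant blk T₂ K₂) :
    HasMajorant blk (T₁ + T₂) (fun a b => K₁ a b + K₂ a b) := by
  intro y' μ B hμ x
  rw [LinearMap.add_apply, Pi.add_apply, add_mul]
  exact (abs_add_le _ _).trans (add_le_add (h₁ y' μ B hμ x) (h₂ y' μ B hμ x))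

/-- Finite sums of operators: the majorants add up. [folklore] -/
theorem hasMajorant_sum (blk : X → g.Site) (T : ℕ → Module.End ℝ (X → ℝ)) (K : ℕ → g.Site → g.Site → ℝ)
    (h : ∀ n, HasMajorant blk (T n) (K n)) (N : ℕ) :
    HasMajorant blk (∑ n ∈ Finset.range N, T n) (fun a b => ∑ n ∈ Finset.range N, K n a b) := by
  induction N with
  | zero => simpa using hasMajorant_zero blk
  | succ N ih =>
      have := hasMajorant_add blk ih (h N)
      simpa [Finset.sum_range_succ] using this

/-- **(2.52) ⇒ (2.55)ₐ** (p. 232): *"this property is preserved under the composition of operators possessing it"* —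
if T₁ has majorant K₁ and T₂ has majorant K₂ ≥ 0 then T₁T₂ has the 𝔅-convolution Σ_{y″} K₁(y,y″)K₂(y″,y′) as
majorant (insert Σ_{y″} Δ(y″) = I between the factors, as in (2.52)). [cite: Balaban1984PropagatorsII, (2.52)–(2.55) p.232] -/
theorem hasMajorant_mul (blk : X → g.Site) {T₁ T₂ : Module.End ℝ (X → ℝ)} {K₁ K₂ : g.Site → g.Site → ℝ}
    (h₁ : HasMajorant blk T₁ K₁) (h₂ : HasMajorant blk T₂ K₂) (hK₂ : ∀ a b, 0 ≤ K₂ a b) :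
    HasMajorant blk (T₁ * T₂) (fun a b => ∑ y'' : g.Site, K₁ a y'' * K₂ y'' b) := by
  intro y' μ B hμ x
  have hν : ∀ x, |T₂ μ x| ≤ K₂ (blk x) y' * B := h₂ y' μ B hμ
  have hpiece : ∀ y'' : g.Site, |T₁ (blockPiece blk y'' (T₂ μ)) x| ≤ K₁ (blk x) y'' * (K₂ y'' y' * B) := fun y'' =>
    h₁ y'' _ _ (blockSupp_blockPiece blk (T₂ μ) y'' (K₂ y'' y' * B) (mul_nonneg (hK₂ _ _) hμ.nonneg)
      (fun x' hx' => by simpa [hx'] using hν x')) x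
  rw [Module.End.mul_apply]
  conv_lhs => rw [← sum_blockPiece blk (T₂ μ), map_sum, Finset.sum_apply]
  refine (Finset.abs_sum_le_sum_abs _ _).trans ?_
  rw [Finset.sum_mul]
  refine Finset.sum_le_sum fun y'' _ => ?_
  simpa [mul_assoc] using hpiece y''

/-- The n-fold composition Tⁿ (n = m + 1 ≥ 1 factors) of an operator with majorant K ≥ 0 has the closed chain
`chain K m` (m intermediate 𝔅-summations) as majorant — (2.52)/(2.55)ₐ for R₁ = … = R_n.
[cite: Balaban1984PropagatorsII, (2.52)–(2.55) p.232] -/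
theorem hasMajorant_pow_chain (blk : X → g.Site) {T : Module.End ℝ (X → ℝ)} {K : g.Site → g.Site → ℝ}
    (h : HasMajorant blk T K) (hK : ∀ a b, 0 ≤ K a b) (m : ℕ) : HasMajorant blk (T ^ (m + 1)) (chain K m) := by
  induction m with
  | zero =>
      intro y' μ B hμ x
      simpa using h y' μ B hμ x
  | succ m ih =>
      rw [pow_succ']
      have := hasMajorant_mul blk h ih (fun a b => chain_nonneg K hK m a b)
      intro y' μ B hμ x
      simpa [chain_succ] using this y' μ B hμ x

/-- Constants pull out of chains: `chain (θ·w) m = θ^{m+1} · chain w m`. [folklore] -/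
theorem chain_const_mul {S : Type} [Fintype S] (θ : ℝ) (w : S → S → ℝ) (m : ℕ) (y y' : S) :
    chain (fun a b => θ * w a b) m y y' = θ ^ (m + 1) * chain w m y y' := by
  induction m generalizing y with
  | zero => simp
  | succ m ih =>
      rw [chain_succ, chain_succ, Finset.mul_sum]
      refine Finset.sum_congr rfl fun z _ => ?_
      rw [ih z]
      ring

/-- c₀(α) ≥ 0. [folklore] -/
theorem c0_nonneg (δ₀ α : ℝ) : 0 ≤ B6.c0 δ₀ α :=
  tsum_nonneg fun _ => (Real.exp_pos _).le

/-- c₁(α) = 12c₀^d(½α) ≥ 0. [folklore] -/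
theorem c1_nonneg (d : ℕ) (δ₀ α : ℝ) : 0 ≤ B6.c1 d δ₀ α := by
  unfold B6.c1
  exact mul_nonneg (by norm_num) (pow_nonneg (c0_nonneg _ _) _)

/-- **(2.64) ⇒ (2.65)** (p. 234): *"Applying this inequality to the n^th power of the operator R in (2.38) we have
|(Rⁿλ)(x)| ≤ (O(M^{−1})c₁)ⁿe^{−½δ₀d(y,y′)}|λ|, (2.65)"* — from the (2.51)-majorant θe^{−δ₀d} of R (θ = O(M⁻¹) ≥ 0)
and (2.63) of Lemma 2.1: Rⁿ has majorant (θc₁(α))ⁿe^{−(1−α)δ₀d(y,y′)} for EVERY n ≥ 0 (α = ½ in print; n = 0 uses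
d(y,y) = 0, (2.46)). [cite: Balaban1984PropagatorsII, (2.64)–(2.65) p.234] -/
theorem majorant_pow_265 (blk : X → g.Site) (d : ℕ) (δ₀ α θ : ℝ) (hθ : 0 ≤ θ)
    (hrefl : ∀ y : g.Site, g.dist y y = 0) (h263 : Ineq263 d g δ₀ α)
    {R : Module.End ℝ (X → ℝ)} (hR : HasMajorant blk R (fun a b => θ * Real.exp (-(δ₀ * g.dist a b)))) (n : ℕ) :
    HasMajorant blk (R ^ n) (fun a b => (θ * B6.c1 d δ₀ α) ^ n * Real.exp (-((1 - α) * δ₀ * g.dist a b))) := by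
  cases n with
  | zero =>
      intro y' μ B hμ x
      by_cases hx : blk x = y'
      · simpa [hx, hrefl y'] using hμ.bound x hx
      · simp only [pow_zero, Module.End.one_apply, hμ.off x hx, abs_zero]
        exact mul_nonneg (by positivity) hμ.nonneg
  | succ m =>
      have hK : ∀ a b : g.Site, 0 ≤ θ * Real.exp (-(δ₀ * g.dist a b)) := fun a b => mul_nonneg hθ (Real.exp_nonneg _)
      refine hasMajorant_mono blk (hasMajorant_pow_chain blk hR hK m) fun a b => ?_
      rw [chain_const_mul, mul_pow, mul_assoc]
      exact mul_le_mul_of_nonneg_left (h263 m a b) (pow_nonneg hθ _)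

/-- **One term of (2.66)** (p. 234): G′₀Rⁿ, with the G′₀-majorant A·P(y)·e^{−δ₀d(y,y″)} ((2.37)/(2.43)/(2.44); P(y) =
(L^jη)², L^jη or (L^jη)^{1−α}) and (2.65), has majorant A c₁(α) P(y) (θc₁(α))ⁿ e^{−(1−α)δ₀d(y,y′)}: the y″-summation of
(2.66) costs one factor c₁(α) by the triangle inequality (2.54) and (2.61). [cite: Balaban1984PropagatorsII, (2.66) p.234] -/
theorem majorant_G0_mul_265 (blk : X → g.Site) (d : ℕ) (δ₀ α A r : ℝ) (P : g.Site → ℝ) (hA : 0 ≤ A)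
    (hP : ∀ y, 0 ≤ P y) (hr : 0 ≤ r) (hαδ : 0 ≤ (1 - α) * δ₀) (htri : Triangle254 g) (h261 : Ineq261 d g δ₀ α)
    {G0 T : Module.End ℝ (X → ℝ)}
    (hG0 : HasMajorant blk G0 (fun a b => A * P a * Real.exp (-(δ₀ * g.dist a b))))
    (hT : HasMajorant blk T (fun a b => r * Real.exp (-((1 - α) * δ₀ * g.dist a b)))) :
    HasMajorant blk (G0 * T)
      (fun a b => A * B6.c1 d δ₀ α * P a * r * Real.exp (-((1 - α) * δ₀ * g.dist a b))) := by
  have hK₂ : ∀ a b : g.Site, 0 ≤ r * Real.exp (-((1 - α) * δ₀ * g.dist a b)) := fun a b =>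
    mul_nonneg hr (Real.exp_nonneg _)
  refine hasMajorant_mono blk (hasMajorant_mul blk hG0 hT hK₂) fun a b => ?_
  -- each summand: split e^{−δ₀d(a,y″)} = e^{−(1−α)δ₀d(a,y″)} e^{−αδ₀d(a,y″)} and use (2.54)
  have hterm : ∀ y'' : g.Site,
      A * P a * Real.exp (-(δ₀ * g.dist a y'')) * (r * Real.exp (-((1 - α) * δ₀ * g.dist y'' b))) ≤
        A * P a * r * Real.exp (-((1 - α) * δ₀ * g.dist a b)) * Real.exp (-(α * δ₀ * g.dist a y'')) := by
    intro y''
    have hexp : Real.exp (-(δ₀ * g.dist a y'')) * Real.exp (-((1 - α) * δ₀ * g.dist y'' b)) ≤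
        Real.exp (-((1 - α) * δ₀ * g.dist a b)) * Real.exp (-(α * δ₀ * g.dist a y'')) := by
      rw [← Real.exp_add, ← Real.exp_add]
      refine Real.exp_le_exp.mpr ?_
      have := mul_le_mul_of_nonneg_left (htri a y'' b) hαδ
      nlinarith
    have := mul_le_mul_of_nonneg_left hexp (mul_nonneg (mul_nonneg hA (hP a)) hr)
    calc A * P a * Real.exp (-(δ₀ * g.dist a y'')) * (r * Real.exp (-((1 - α) * δ₀ * g.dist y'' b)))
        = A * P a * r * (Real.exp (-(δ₀ * g.dist a y'')) * Real.exp (-((1 - α) * δ₀ * g.dist y'' b))) := by ring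
      _ ≤ A * P a * r * (Real.exp (-((1 - α) * δ₀ * g.dist a b)) * Real.exp (-(α * δ₀ * g.dist a y''))) := this
      _ = _ := by ring
  calc ∑ y'' : g.Site, A * P a * Real.exp (-(δ₀ * g.dist a y'')) * (r * Real.exp (-((1 - α) * δ₀ * g.dist y'' b)))
      ≤ ∑ y'' : g.Site, A * P a * r * Real.exp (-((1 - α) * δ₀ * g.dist a b)) *
          Real.exp (-(α * δ₀ * g.dist a y'')) := Finset.sum_le_sum fun y'' _ => hterm y''
    _ = A * P a * r * Real.exp (-((1 - α) * δ₀ * g.dist a b)) *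
          ∑ y'' : g.Site, Real.exp (-(α * δ₀ * g.dist a y'')) := by rw [Finset.mul_sum]
    _ ≤ A * P a * r * Real.exp (-((1 - α) * δ₀ * g.dist a b)) * B6.c1 d δ₀ α :=
        mul_le_mul_of_nonneg_left (h261 a)
          (mul_nonneg (mul_nonneg (mul_nonneg hA (hP a)) hr) (Real.exp_nonneg _))
    _ = A * B6.c1 d δ₀ α * P a * r * Real.exp (-((1 - α) * δ₀ * g.dist a b)) := by ring

/-- **(2.66), the partial sums of (2.50)** (p. 234): *"|(G′λ)(x)| ≤ Σ_{n=0}^∞ |(G′₀Rⁿλ)(x)| ≤ … ≤ O(1)(L^jη)²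
e^{−½δ₀d(y,y′)}|λ|"* — every partial sum Σ_{n<N} G′₀Rⁿ has majorant A c₁(α)(1 − θc₁(α))⁻¹ P(y) e^{−(1−α)δ₀d(y,y′)},
UNIFORMLY in N, under the located smallness θc₁(α) < 1 (*"M is sufficiently large"*).
[cite: Balaban1984PropagatorsII, (2.66) p.234] -/
theorem majorant_partialSum_266 (blk : X → g.Site) (d : ℕ) (δ₀ α θ A : ℝ) (P : g.Site → ℝ) (hA : 0 ≤ A)
    (hP : ∀ y, 0 ≤ P y) (hθ : 0 ≤ θ) (hαδ : 0 ≤ (1 - α) * δ₀) (htri : Triangle254 g)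
    (hrefl : ∀ y : g.Site, g.dist y y = 0) (h261 : Ineq261 d g δ₀ α) (h263 : Ineq263 d g δ₀ α)
    (hsmall : θ * B6.c1 d δ₀ α < 1) {G0 R : Module.End ℝ (X → ℝ)}
    (hG0 : HasMajorant blk G0 (fun a b => A * P a * Real.exp (-(δ₀ * g.dist a b))))
    (hR : HasMajorant blk R (fun a b => θ * Real.exp (-(δ₀ * g.dist a b)))) (N : ℕ) :
    HasMajorant blk (∑ n ∈ Finset.range N, G0 * R ^ n)
      (fun a b => A * B6.c1 d δ₀ α * (1 - θ * B6.c1 d δ₀ α)⁻¹ * P a *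
        Real.exp (-((1 - α) * δ₀ * g.dist a b))) := by
  set q : ℝ := θ * B6.c1 d δ₀ α with hq
  have hq0 : 0 ≤ q := mul_nonneg hθ (c1_nonneg d δ₀ α)
  have hterm : ∀ n, HasMajorant blk (G0 * R ^ n)
      (fun a b => A * B6.c1 d δ₀ α * P a * q ^ n * Real.exp (-((1 - α) * δ₀ * g.dist a b))) := fun n =>
    majorant_G0_mul_265 blk d δ₀ α A (q ^ n) P hA hP (pow_nonneg hq0 n) hαδ htri h261 hG0
      (majorant_pow_265 blk d δ₀ α θ hθ hrefl h263 hR n)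
  refine hasMajorant_mono blk (hasMajorant_sum blk (fun n => G0 * R ^ n) _ hterm N) fun a b => ?_
  have hgeom : ∑ n ∈ Finset.range N, q ^ n ≤ (1 - q)⁻¹ :=
    sum_le_hasSum (Finset.range N) (fun n _ => pow_nonneg hq0 n) (hasSum_geometric_of_lt_one hq0 hsmall)
  have hC : 0 ≤ A * B6.c1 d δ₀ α * P a * Real.exp (-((1 - α) * δ₀ * g.dist a b)) :=
    mul_nonneg (mul_nonneg (mul_nonneg hA (c1_nonneg d δ₀ α)) (hP a)) (Real.exp_nonneg _)
  calc ∑ n ∈ Finset.range N, A * B6.c1 d δ₀ α * P a * q ^ n * Real.exp (-((1 - α) * δ₀ * g.dist a b))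
      = A * B6.c1 d δ₀ α * P a * Real.exp (-((1 - α) * δ₀ * g.dist a b)) * ∑ n ∈ Finset.range N, q ^ n := by
        rw [Finset.mul_sum]; refine Finset.sum_congr rfl fun n _ => ?_; ring
    _ ≤ A * B6.c1 d δ₀ α * P a * Real.exp (-((1 - α) * δ₀ * g.dist a b)) * (1 - q)⁻¹ :=
        mul_le_mul_of_nonneg_left hgeom hC
    _ = _ := by ring

/-- Every linear operator on the functions on a FINITE lattice is bounded in the sup norm: |(Tμ)(x)| ≤ E·sup|μ|
(expand μ in the basis of point masses).  Used only to pass to the limit N → ∞ in (2.50). [folklore] -/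
theorem exists_opBound [Fintype X] [DecidableEq X] (T : Module.End ℝ (X → ℝ)) :
    ∃ E : ℝ, 0 ≤ E ∧ ∀ (μ : X → ℝ) (B : ℝ), 0 ≤ B → (∀ x, |μ x| ≤ B) → ∀ x, |T μ x| ≤ E * B := by
  refine ⟨∑ x' : X, ∑ x : X, |T (Pi.single x' 1) x|, Finset.sum_nonneg fun _ _ => Finset.sum_nonneg fun _ _ =>
    abs_nonneg _, fun μ B hB hμ x => ?_⟩
  have hdec : μ = ∑ x' : X, μ x' • (Pi.single x' (1 : ℝ) : X → ℝ) := by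
    funext z
    rw [Finset.sum_apply]
    simp [Pi.single_apply]
  have hTμ : T μ x = ∑ x' : X, μ x' * T (Pi.single x' 1) x := by
    conv_lhs => rw [hdec, map_sum, Finset.sum_apply]
    refine Finset.sum_congr rfl fun x' _ => ?_
    rw [map_smul, Pi.smul_apply, smul_eq_mul]
  rw [hTμ]
  calc |∑ x' : X, μ x' * T (Pi.single x' 1) x|
      ≤ ∑ x' : X, |μ x' * T (Pi.single x' 1) x| := Finset.abs_sum_le_sum_abs _ _
    _ = ∑ x' : X, |μ x'| * |T (Pi.single x' 1) x| := Finset.sum_congr rfl fun x' _ => abs_mul _ _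
    _ ≤ ∑ x' : X, B * |T (Pi.single x' 1) x| :=
        Finset.sum_le_sum fun x' _ => mul_le_mul_of_nonneg_right (hμ x') (abs_nonneg _)
    _ = (∑ x' : X, |T (Pi.single x' 1) x|) * B := by
        rw [Finset.sum_mul]; exact Finset.sum_congr rfl fun _ _ => mul_comm _ _
    _ ≤ (∑ x' : X, ∑ x : X, |T (Pi.single x' 1) x|) * B :=
        mul_le_mul_of_nonneg_right (Finset.sum_le_sum fun x' _ =>
          Finset.single_le_sum (fun z _ => abs_nonneg (T (Pi.single x' 1) z)) (Finset.mem_univ x)) hB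

/-- (2.50), algebra: if G′ = G′₀ + G′R then G′ = Σ_{n<N} G′₀Rⁿ + G′R^N for every N. [folklore] -/
theorem fixedPoint_telescope {G' G0 R : Module.End ℝ (X → ℝ)} (hfix : G' = G0 + G' * R) (N : ℕ) :
    G' = (∑ n ∈ Finset.range N, G0 * R ^ n) + G' * R ^ N := by
  induction N with
  | zero => simp
  | succ N ih =>
      calc G' = (∑ n ∈ Finset.range N, G0 * R ^ n) + G' * R ^ N := ih
        _ = (∑ n ∈ Finset.range N, G0 * R ^ n) + (G0 + G' * R) * R ^ N := by rw [← hfix]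
        _ = (∑ n ∈ Finset.range (N + 1), G0 * R ^ n) + G' * R ^ (N + 1) := by
            rw [add_mul, mul_assoc, ← pow_succ', Finset.sum_range_succ, add_assoc]

/-- **(2.66) ⇒ the first entry of (2.67), for the operator itself**: any linear operator G′ on the finite lattice with
G′ = G′₀ + G′R — which is what (2.38) *"Δ′_aG′₀ = I − R"* gives for G′ = Δ′_a^{−1}, i.e. (2.50) *"G′ = G′₀(I − R)^{−1}
= G′₀ Σ_{n=0}^∞ Rⁿ"* — has majorant A c₁(α)(1 − θc₁(α))⁻¹ P(y) e^{−(1−α)δ₀d(y,y′)}: the remainder G′R^N is killed by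
(2.65) as N → ∞ (*"The random walk representation (2.50) is convergent in the norms defined by these inequalities"*).
With α = ½, θ = O(M⁻¹) of (2.51), A·P(y) = O(1)(L^jη)² of (2.44) this is *"|(G′λ)(x)| ≤ O(1)(L^jη)²e^{−½δ₀d(y,y′)}|λ|"*
with O(1) = A c₁(½)/(1 − O(M⁻¹)c₁(½)) explicit — valid exactly under the LOCATED smallness O(M⁻¹)c₁(½) < 1
(*"M is sufficiently large"*). [cite: Balaban1984PropagatorsII, Prop. 2.2 (2.66)–(2.67) p.234] -/
theorem majorant_of_fixedPoint_266 [Fintype X] [DecidableEq X] (blk : X → g.Site) (d : ℕ) (δ₀ α θ A : ℝ) (P : g.Site → ℝ)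
    (hA : 0 ≤ A) (hP : ∀ y, 0 ≤ P y) (hθ : 0 ≤ θ) (hαδ : 0 ≤ (1 - α) * δ₀) (htri : Triangle254 g)
    (hrefl : ∀ y : g.Site, g.dist y y = 0) (hdnn : ∀ y y' : g.Site, 0 ≤ g.dist y y')
    (h261 : Ineq261 d g δ₀ α) (h263 : Ineq263 d g δ₀ α) (hsmall : θ * B6.c1 d δ₀ α < 1)
    {G' G0 R : Module.End ℝ (X → ℝ)}
    (hG0 : HasMajorant blk G0 (fun a b => A * P a * Real.exp (-(δ₀ * g.dist a b))))
    (hR : HasMajorant blk R (fun a b => θ * Real.exp (-(δ₀ * g.dist a b)))) (hfix : G' = G0 + G' * R) :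
    HasMajorant blk G'
      (fun a b => A * B6.c1 d δ₀ α * (1 - θ * B6.c1 d δ₀ α)⁻¹ * P a *
        Real.exp (-((1 - α) * δ₀ * g.dist a b))) := by
  intro y' μ B hμ x
  obtain ⟨E, hE, hEb⟩ := exists_opBound G'
  set q : ℝ := θ * B6.c1 d δ₀ α with hq
  have hq0 : 0 ≤ q := mul_nonneg hθ (c1_nonneg d δ₀ α)
  set C : ℝ := A * B6.c1 d δ₀ α * (1 - q)⁻¹ * P (blk x) * Real.exp (-((1 - α) * δ₀ * g.dist (blk x) y')) * B
    with hC
  -- for every N: |G′μ(x)| ≤ C + E·q^N·B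
  have hN : ∀ N : ℕ, |G' μ x| ≤ C + E * B * q ^ N := by
    intro N
    have hS := majorant_partialSum_266 blk d δ₀ α θ A P hA hP hθ hαδ htri hrefl h261 h263 hsmall hG0 hR N y' μ B hμ x
    have hRN := majorant_pow_265 blk d δ₀ α θ hθ hrefl h263 hR N y' μ B hμ
    -- sup bound of R^N μ: q^N · B (drop e^{−(1−α)δ₀d} ≤ 1)
    have hsup : ∀ z, |(R ^ N) μ z| ≤ q ^ N * B := fun z => by
      refine (hRN z).trans ?_
      refine mul_le_mul_of_nonneg_right ?_ hμ.nonneg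
      have : Real.exp (-((1 - α) * δ₀ * g.dist (blk z) y')) ≤ 1 := by
        rw [Real.exp_le_one_iff]
        have := mul_nonneg hαδ (hdnn (blk z) y')
        linarith
      simpa [hq] using mul_le_mul_of_nonneg_left this (pow_nonneg hq0 N)
    have hrem : |(G' * R ^ N) μ x| ≤ E * (q ^ N * B) := by
      rw [Module.End.mul_apply]
      exact hEb _ _ (mul_nonneg (pow_nonneg hq0 N) hμ.nonneg) hsup x
    have hsplit : G' μ x = (∑ n ∈ Finset.range N, G0 * R ^ n) μ x + (G' * R ^ N) μ x := by
      conv_lhs => rw [fixedPoint_telescope hfix N]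
      rfl
    rw [hsplit]
    refine (abs_add_le _ _).trans ?_
    have h1 : |(∑ n ∈ Finset.range N, G0 * R ^ n) μ x| ≤ C := by simpa [hC, hq] using hS
    nlinarith [hrem, h1]
  -- let N → ∞
  have hlim : Filter.Tendsto (fun N : ℕ => C + E * B * q ^ N) Filter.atTop (nhds (C + E * B * 0)) :=
    ((tendsto_pow_atTop_nhds_zero_of_lt_one hq0 hsmall).const_mul (E * B)).const_add C
  rw [mul_zero, add_zero] at hlim
  have := ge_of_tendsto' hlim hN
  simpa [hC, hq] using this

end Prop22Chain

/-! ## Proposition 2.6 — "Reasoning in the same way as in the proof of Proposition 2.2" (surge node T03.6)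

[Balaban1984PropagatorsII] p. 247 [PDF 25]: from the rescaled local bounds (2.133) of Prop. 2.5 (*"|(G□J)(x)|,
|(∇G□J)(x)| ≤ O(1)[(L^jη)², L^jη]e^{−δ₂(L^jη)^{−1}dist(Δ,Δ′)}|J|, for x ∈ Δ(y), supp J ⊂ Δ(y′), y, y′ ∈ 𝔅 ∩ T□"*),
(2.88) and *"the remarks after the inequality (2.68)"* the paper obtains (2.134) and *"this together with (2.91)
implies |(RJ)(x)| ≤ O(M^{−1})e^{−½δ₂d(y,y′)}|J|, x ∈ Δ(y), supp J ⊂ Δ(y′). (2.135) Reasoning in the same way as in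
the proof of Proposition 2.2 we obtain Proposition 2.6"* — (2.136) with *"a positive constant δ₃ depending on d
and L only"* and *"the constant O(1) depending on d and L only"*, and (2.141) *"G = G₀(I − R)^{−1} = Σ_{n=0}^∞ G₀Rⁿ
= … and the series above is convergent in the norms appearing in the inequalities (2.136)–(2.140)"*, where (2.91)
p. 239 [PDF 17] is *"Δ_aG₀ = I − Σ_{□,□′∈𝒟} K_{□,□′}G_{□′}h_{□′} = I − R"* with *"G₀ = Σ_{□∈𝒟} h□G□h□"*.
KERNEL-CHECKED here: the words "reasoning in the same way" ARE an instance of `majorant_of_fixedPoint_266` — the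
block-majorant chain of Sect. `Prop22Chain` is stated for an arbitrary rate, so it applies verbatim at the rate ½δ₂
of (2.135) in place of the δ₀ of (2.51): `prop26_chain_2136`.  What the instance makes EXPLICIT (cell GAPS G-pv08-3,
SMALLNESS S-B6.2): (i) Lemma 2.1 is used at the rate ½δ₂, i.e. with the constants c₁ = 12c₀^d computed from ½δ₂
(`B6.c1 d (δ₂/2) α`) and under its hypothesis (2.59) at that rate; (ii) the geometric series needs the smallness
O(M^{−1})·c₁(d, ½δ₂, α) < 1 — Prop. 2.6 does not repeat Prop. 2.2's *"M is sufficiently large"*, it inherits it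
through (2.134)–(2.135) (the sibling module's `B6.Prop26Printed` carries `M₁ ≤ M` accordingly); (iii) the printed
δ₃ is (1 − α)·½δ₂ (`delta3`; α = ½ as on p. 234 gives δ₃ = ¼δ₂) — a function of δ₂ and α alone, hence *"depending
on d and L only"* exactly insofar as δ₂ does (Prop. 2.5: *"This constant depends on d and L only"*); (iv) the
printed O(1) is A·c₁·(1 − O(M^{−1})c₁)^{−1} (`const2136`), which depends on d and L only ONCE the M-margin is fixed
— e.g. O(M^{−1})c₁ ≤ ½ gives O(1) ≤ 2A c₁ (`const2136_le_of_margin`).  NOT typed: (2.133) ⇒ (2.134) (GAPS G-B6-11),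
the euclidean-vs-d comparison putting (2.133) into the d-decaying G₀-majorant (as G-pv08-1), and the Hölder / L²
entries (2.137)–(2.140), whose input/output norms differ from the sup-norm shape of `HasMajorant`. -/

section Prop26Chain

variable {g : B6.Geometry} {X : Type}

/-- The decay rate delivered by the chain for Prop. 2.6: δ₃ = (1 − α)·½δ₂ (rate ½δ₂ of (2.135), loss factor
(1 − α) of (2.63); α = ½ in print). [cite: Balaban1984PropagatorsII, Prop. 2.6 (2.136) p.247] -/
noncomputable def delta3 (α δ₂ : ℝ) : ℝ := (1 - α) * (δ₂ / 2)

/-- *"a positive constant δ₃"*: δ₃ > 0 as soon as δ₂ > 0 and α < 1. [cite: Balaban1984PropagatorsII, Prop. 2.6 p.247] -/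
theorem delta3_pos {α δ₂ : ℝ} (hα : α < 1) (hδ₂ : 0 < δ₂) : 0 < delta3 α δ₂ :=
  mul_pos (by linarith) (by linarith)

/-- The constant O(1) of (2.136) delivered by the chain: A·c₁(d, ½δ₂, α)·(1 − θc₁(d, ½δ₂, α))^{−1}, where A is the
O(1) of the G₀-majorant ((2.133), Prop. 2.5: d, L only) and θ the O(M^{−1}) of (2.135).
[cite: Balaban1984PropagatorsII, Prop. 2.6 (2.136) p.247] -/
noncomputable def const2136 (d : ℕ) (δ₂ α θ A : ℝ) : ℝ :=
  A * B6.c1 d (δ₂ / 2) α * (1 - θ * B6.c1 d (δ₂ / 2) α)⁻¹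

/-- *"with the constant O(1) depending on d and L only"* — made precise: under a FIXED margin of the inherited
M-largeness, θc₁ ≤ ½, the constant is at most 2A c₁(d, ½δ₂, α), a function of A, d, δ₂, α alone (LOCATED: without a
fixed margin the printed O(1) degenerates as θc₁ → 1). [cite: Balaban1984PropagatorsII, Prop. 2.6 p.247] -/
theorem const2136_le_of_margin (d : ℕ) (δ₂ α θ A : ℝ) (hA : 0 ≤ A)
    (hmargin : θ * B6.c1 d (δ₂ / 2) α ≤ 1 / 2) : const2136 d δ₂ α θ A ≤ 2 * A * B6.c1 d (δ₂ / 2) α := by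
  unfold const2136
  have hc : 0 ≤ B6.c1 d (δ₂ / 2) α := c1_nonneg d (δ₂ / 2) α
  have hq : (1 / 2 : ℝ) ≤ 1 - θ * B6.c1 d (δ₂ / 2) α := by linarith
  have hinv : (1 - θ * B6.c1 d (δ₂ / 2) α)⁻¹ ≤ 2 := by
    calc (1 - θ * B6.c1 d (δ₂ / 2) α)⁻¹ ≤ (1 / 2 : ℝ)⁻¹ := inv_anti₀ (by norm_num) hq
      _ = 2 := by norm_num
  calc A * B6.c1 d (δ₂ / 2) α * (1 - θ * B6.c1 d (δ₂ / 2) α)⁻¹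
      ≤ A * B6.c1 d (δ₂ / 2) α * 2 := mul_le_mul_of_nonneg_left hinv (mul_nonneg hA hc)
    _ = 2 * A * B6.c1 d (δ₂ / 2) α := by ring

/-- **Prop. 2.6, first entries of (2.136), by "reasoning in the same way as in the proof of Proposition 2.2"**
(p. 247) — KERNEL-CHECKED as the instance of `majorant_of_fixedPoint_266` at the rate ½δ₂: if R has the
(2.135)-majorant θe^{−½δ₂d(y,y′)} (θ = O(M^{−1}) ≥ 0), G₀ = Σ_□ h□G□h□ has a majorant A·P(y)·e^{−½δ₂d(y,y″)}
((2.133) after the euclidean-vs-d comparison; P(y) = (L^jη)², L^jη, L^jη, 1 for the four entries), Lemma 2.1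
holds at the rate ½δ₂ ((2.61), (2.63) with `B6.c1 d (δ₂/2) α`), θ·c₁ < 1 (inherited M-largeness) and
G = G₀ + GR ((2.91) with G = Δ_a^{−1}, i.e. (2.141)), then G has the majorant
`const2136`·P(y)·e^{−δ₃d(y,y′)} with δ₃ = `delta3 α δ₂`. [cite: Balaban1984PropagatorsII, Prop. 2.6 (2.136), (2.141) p.247] -/
theorem prop26_chain_2136 [Fintype X] [DecidableEq X] (blk : X → g.Site) (d : ℕ) (δ₂ α θ A : ℝ)
    (P : g.Site → ℝ) (hA : 0 ≤ A) (hP : ∀ y, 0 ≤ P y) (hθ : 0 ≤ θ) (hα : α ≤ 1) (hδ₂ : 0 ≤ δ₂)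
    (htri : Triangle254 g) (hrefl : ∀ y : g.Site, g.dist y y = 0) (hdnn : ∀ y y' : g.Site, 0 ≤ g.dist y y')
    (h261 : Ineq261 d g (δ₂ / 2) α) (h263 : Ineq263 d g (δ₂ / 2) α) (hsmall : θ * B6.c1 d (δ₂ / 2) α < 1)
    {G G0 R : Module.End ℝ (X → ℝ)}
    (hG0 : HasMajorant blk G0 (fun a b => A * P a * Real.exp (-(δ₂ / 2 * g.dist a b))))
    (hR : HasMajorant blk R (fun a b => θ * Real.exp (-(δ₂ / 2 * g.dist a b)))) (hfix : G = G0 + G * R) :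
    HasMajorant blk G (fun a b => const2136 d δ₂ α θ A * P a * Real.exp (-(delta3 α δ₂ * g.dist a b))) := by
  have hαδ : 0 ≤ (1 - α) * (δ₂ / 2) := mul_nonneg (by linarith) (by linarith)
  have h := majorant_of_fixedPoint_266 blk d (δ₂ / 2) α θ A P hA hP hθ hαδ htri hrefl hdnn h261 h263 hsmall
    hG0 hR hfix
  intro y' μ B hμ x
  have := h y' μ B hμ x
  simpa [const2136, delta3, mul_assoc] using this

end Prop26Chain

end Literature.MathematicalPhysics.QuantumFieldTheory.Balaban1983to89.B6RandomWalk
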